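import Summits.ABC.ABC.Theorems.StewartYu2001ThmTwoOfKummerThird
import Summits.ABC.ABC.Theorems.PadicPrimesKummerThirdY07Odd
import Summits.ABC.ABC.Theorems.PadicPrimesKummerThirdY07Two
import HarnessLib

/-!
# Rung A1.M3⁺ by name: Stewart–Yu 2001 Theorem 2 (`z < exp(p′ · G^{c log₃G⋆/log₂G})`) — UNCONDITIONAL

`Summits/ABC/ABC/Theorems/StewartYu2001ThmTwoHolds.lean` — cell `abc-stewartyu` (planner-staged template
HOME/plan/m3/closers/StewartYu2001ThmTwoHolds.lean, planner g8; filed by p4-g4 after both crux closers of `PadicPrimesKummerThird` landed: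
`Y07Odd_proof` (stmt-ABC-19658), `Y07Two_proof` (stmt-ABC-19659)); the edge is p4-g3's `stewartYu2001_thm2_of_y07` (p470575).
BY-NAME corollaries in the tree: `StewartYu2001.stewartYu1991_of_thm2` (⇒ A1.M2), `StewartYu2001.epsShapeBound_third_of_thm2` (⇒ ε-column 1/3).
[folklore] assembly.
-/

set_option linter.dupNamespace false

namespace Summit.ABC.ABC.Theorems

open Summit.ABC.ABC.Theses

/-- **Rung A1.M3⁺ — Stewart–Yu 2001 Theorem 2 holds.** [cite: StewartYu2001, Theorem 2] -/
theorem stewartYu2001_thm2_holds : Literature.NumberTheory.DiophantineGeometry.stewartYu2001_thm2 :=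
  stewartYu2001_thm2_of_y07 Y07Odd_proof Y07Two_proof

end Summit.ABC.ABC.Theorems
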